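import Summits.ResolutionOfSingularities.ResolutionOfSingularities.Theorems.SharpStrataSepExcModelsDvrPairValuationComposite
import Literature.AlgebraicGeometry.Resolution.ValuedFunctionFieldsLemmas
import Literature.AlgebraicGeometry.Resolution.TranscendenceDefect
import Mathlib.RingTheory.Localization.LocalizationLocalization
import HarnessLib

/-!
# A DVR pair carries a residually rational Abhyankar valuation

Line `birth` of crux `SharpStrata.SepExcModels` (stmt-ResolutionOfSingularities-16828,
`Cruxes/SepExcModels/Lines/birth.lean`), lead c1, tool stub (T3, ring form)
`stub_ratAbhyankarPlace_of_dvrPair`, PROVED.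

Setting: `R` a local domain with fraction field `K` over a field `k`, `P` a prime of `R` with
`W = R_P` a discrete valuation ring and `R ⧸ P` a discrete valuation ring (a DVR FLAG of length
two), `y₁, …, y_τ ∈ R` with residues algebraically independent over `k`, and
`tr.deg_k K ≤ τ + 2`. Conclusion: a valuation ring `O` of `K` containing `R`, dominating it
(`𝔪_R ⊆ 𝔪_O`), an ABHYANKAR place of `K | k` (`IsAbhyankarPlace`,
`Literature/…/ValuedFunctionFields.lean`) and RESIDUALLY RATIONAL over `R` (every element of `O`
is congruent to an element of `R` modulo `𝔪_O`).

## Proof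

The valuation ring is the COMPOSITE `O = {x ∈ W | x̄ ∈ R ⧸ P}` of the two discrete valuations
(`exists_composite_valuationSubring`, file
`Theorems/SharpStrataSepExcModelsDvrPairValuationComposite.lean`, where containment of `R`,
domination, residual rationality and the `ℤ`-independence of the values of `π ∈ P ∖ 0` and
`t ∈ R ∖ P` lifting a non-unit of `R ⧸ P` are proved).

* `isAbhyankarPlace_of_valuation_zpow` — a valuation ring `O ⊇ R` of `K` dominating the local
  ring `R`, with two elements `x₀, x₁ ∈ K` whose values are `ℤ`-independent, is an Abhyankar
  place of `K | k` as soon as `R` contains `y₁, …, y_τ` with residues algebraically independent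
  over `k` and `tr.deg_k K ≤ τ + 2`: the residue field `κ(R)` embeds into `κ(O)` (domination),
  so the residues of the `y_j` stay algebraically independent, over `k` and over the residue
  field of (the image of) `k`, onto which `k` surjects; distinct monomials in `x₀, x₁` have
  distinct values; hence `(x₀, x₁, y)` is algebraically independent over `k` by Knaf–Kuhlmann
  2005, Thm. 2.1 (`algebraicIndependent_sumElim_of_valuation`, `TranscendenceDefect.lean`), so —
  its cardinality `τ + 2` bounding `tr.deg_k K` — a transcendence basis
  (`AlgebraicIndependent.isTranscendenceBasis_of_trdeg_le_of_finite`), and `K` is algebraic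
  over `k(x₀, x₁, y)` (`IsTranscendenceBasis.isAlgebraic_field`).
* `stub_ratAbhyankarPlace_of_dvrPair` — the registered stub: realise the abstract localisation
  `W` inside `K = Frac R = Frac W` (`IsLocalization.lift`,
  `IsFractionRing.isFractionRing_of_isDomain_of_isLocalization`), take the composite valuation
  ring and the two elements `π, t` of `exists_composite_valuationSubring`, and conclude.

## Sources

* H. Knaf, F.-V. Kuhlmann, *Abhyankar places admit local uniformization in any characteristic*,
  Ann. Sci. ÉNS 38 (2005) 833–846, Thm. 2.1. [KnafKuhlmann2005]
* O. Zariski, P. Samuel, *Commutative Algebra* II, Ch. VI § 10 (composite valuations). [folklore]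
-/

noncomputable section

-- single-problem summit: the doubled namespace component `ResolutionOfSingularities` is forced
set_option linter.dupNamespace false

open Literature.AlgebraicGeometry.Resolution IsLocalRing
open Summit.ResolutionOfSingularities.ResolutionOfSingularities.Theorems.SepExcModels.DvrPairValuationComposite

namespace Summit.ResolutionOfSingularities.ResolutionOfSingularities.Theorems.SepExcModels.DvrPairValuation

section Abhyankar

variable {k K R : Type} [Field k] [Field K] [Algebra k K]
  [CommRing R] [IsLocalRing R] [Algebra R K] [Algebra k R] [IsScalarTower k R K]

/-- **A residually dominated valuation ring with two `ℤ`-independent values is an Abhyankar place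
of `K | k`.** Let `R ⊆ O` be local, dominated by the valuation ring `O` of `K` (`𝔪_R ⊆ 𝔪_O`),
`x₀, x₁ ∈ Kˣ` with `v_O(x₀ ^ a * x₁ ^ b) = 1 ⇒ a = b = 0`, and `y₁, …, y_τ ∈ R` with residues
algebraically independent over `k`, where `tr.deg_k K ≤ τ + 2`. Then `O` is an Abhyankar place of
`K` over (the image of) `k`, with witnesses `x = (x₀, x₁)` and `y`: the residues of the `y_j` in
`κ(O) ⊇ κ(R)` are algebraically independent over the residue field of `k`, and `(x₀, x₁, y)` is
algebraically independent over `k` (Knaf–Kuhlmann 2005, Thm. 2.1: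
`algebraicIndependent_sumElim_of_valuation`), hence a transcendence basis, so that `K` is
algebraic over `k(x₀, x₁, y)`. [cite: KnafKuhlmann2005, Thm. 2.1] -/
theorem isAbhyankarPlace_of_valuation_zpow (O : ValuationSubring K)
    (hRO : ∀ r : R, algebraMap R K r ∈ O)
    (hdom : ∀ r ∈ maximalIdeal R, O.valuation (algebraMap R K r) < 1)
    {x₀ x₁ : K} (hx₀ : x₀ ≠ 0) (hx₁ : x₁ ≠ 0)
    (hind : ∀ a b : ℤ, O.valuation (x₀ ^ a * x₁ ^ b) = 1 → a = 0 ∧ b = 0)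
    {τ : ℕ} (y : Fin τ → R) (hy : AlgebraicIndependent k fun j => IsLocalRing.residue R (y j))
    (htr : Algebra.trdeg k K ≤ (τ + 2 : ℕ)) :
    IsAbhyankarPlace O (algebraMap k K).fieldRange ⊤ := by
  have hkO : ∀ c : k, algebraMap k K c ∈ O := fun c => by
    rw [IsScalarTower.algebraMap_apply k R K]
    exact hRO _
  -- the maps `R → O` and `κ(R) → κ(O)`
  let ιRO : R →+* O := (algebraMap R K).codRestrict O hRO
  let φ : ResidueField R →+* ResidueField O :=
    Ideal.Quotient.lift (maximalIdeal R) ((residue O).comp ιRO) fun r hr =>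
      (residue_eq_zero_iff _).mpr ((ValuationSubring.valuation_lt_one_iff O _).mpr (hdom r hr))
  -- the witnesses
  let xv : Fin 2 → K := ![x₀, x₁]
  let yO : Fin τ → O := fun j => ιRO (y j)
  have hxv0 : xv 0 = x₀ := rfl
  have hxv1 : xv 1 = x₁ := rfl
  refine ⟨2, τ, xv, fun j => (yO j : K), fun j => (yO j).2, ?_, fun _ => Subfield.mem_top _,
    ?_, ?_, ?_⟩
  · intro i
    refine ⟨Subfield.mem_top _, ?_⟩
    fin_cases i
    exacts [hx₀, hx₁]
  · -- `ℤ`-independence of the values of `x₀, x₁` modulo `v(k) = 1`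
    rintro m ⟨b, hb, hm⟩
    rw [Fin.prod_univ_two, hxv0, hxv1, ← map_zpow₀ O.valuation, ← map_zpow₀ O.valuation,
      ← map_mul] at hm
    have hb0 : b ≠ 0 := by
      rintro rfl
      rw [map_zero, Valuation.zero_iff] at hm
      exact mul_ne_zero (zpow_ne_zero _ hx₀) (zpow_ne_zero _ hx₁) hm
    have hb1 : O.valuation b = 1 := by
      obtain ⟨c, rfl⟩ := RingHom.mem_fieldRange.mp hb
      exact (O.valuation_eq_one_iff ⟨_, hkO c⟩).mp
        (isUnit_of_inv_mem O (hkO c) (by rw [← map_inv₀]; exact hkO _) hb0)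
    rw [hb1] at hm
    obtain ⟨h0, h1⟩ := hind _ _ hm
    exact funext (Fin.forall_fin_two.mpr ⟨h0, h1⟩)
  · -- the residues of the `y_j` are algebraically independent over the residue field of `k`
    have hcK : ∀ c : k, ((ιRO (algebraMap k R c) : O) : K) ∈ (algebraMap k K).fieldRange :=
      fun c => RingHom.mem_fieldRange.mpr ⟨c, IsScalarTower.algebraMap_apply k R K c⟩
    let fk : k →+* resField O (algebraMap k K).fieldRange :=
      ((residue O).comp (ιRO.comp (algebraMap k R))).codRestrict
        (resField O (algebraMap k K).fieldRange) fun c => residue_mem_resField O _ (hcK c)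
    have hfk : Function.Surjective fk := by
      rintro ⟨z, hz⟩
      obtain ⟨a, haK, rfl⟩ := (mem_resField_iff O _ z).mp hz
      obtain ⟨c, hc⟩ := RingHom.mem_fieldRange.mp haK
      refine ⟨c, Subtype.ext ?_⟩
      show residue O (ιRO (algebraMap k R c)) = residue O a
      congr 1
      exact Subtype.ext ((IsScalarTower.algebraMap_apply k R K c).symm.trans hc)
    exact hy.ringHom_of_comp_eq fk φ hfk φ.injective (RingHom.ext fun _ => rfl)
  · -- `K` is algebraic over `k(x₀, x₁, y)`
    letI : Algebra k O := algebraOfMem k O hkO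
    haveI : IsScalarTower k O K := isScalarTower_algebraOfMem k O hkO
    have hres : AlgebraicIndependent k fun j => residue O (yO j) := by
      refine hy.ringHom_of_comp_eq (RingHom.id k) φ Function.surjective_id φ.injective
        (RingHom.ext fun c => ?_)
      change residue O ⟨algebraMap k K c, hkO c⟩ = residue O (ιRO (algebraMap k R c))
      congr 1
      exact Subtype.ext (IsScalarTower.algebraMap_apply k R K c)
    have hinj : Function.Injective
        fun μ : Fin 2 →₀ ℕ => O.valuation (μ.prod fun j n => xv j ^ n) := by
      intro μ ν h
      simp only [Finsupp.prod_pow, Fin.prod_univ_two, hxv0, hxv1] at h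
      have key : O.valuation (x₀ ^ ((μ 0 : ℤ) - ν 0) * x₁ ^ ((μ 1 : ℤ) - ν 1)) = 1 := by
        rw [zpow_sub₀ hx₀, zpow_sub₀ hx₁, div_mul_div_comm, map_div₀]
        simp only [zpow_natCast]
        rw [h]
        exact div_self ((Valuation.ne_zero_iff _).mpr
          (mul_ne_zero (pow_ne_zero _ hx₀) (pow_ne_zero _ hx₁)))
      obtain ⟨h0, h1⟩ := hind _ _ key
      exact Finsupp.ext (Fin.forall_fin_two.mpr ⟨by omega, by omega⟩)
    have hai : AlgebraicIndependent k (Sum.elim xv fun j => (yO j : K)) :=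
      algebraicIndependent_sumElim_of_valuation O yO hres xv hinj
    have hcard : Cardinal.mk (Fin 2 ⊕ Fin τ) = ((τ + 2 : ℕ) : Cardinal) := by
      simp [add_comm]
    have htb : IsTranscendenceBasis k (Sum.elim xv fun j => (yO j : K)) :=
      hai.isTranscendenceBasis_of_trdeg_le_of_finite (htr.trans_eq hcard.symm)
    have halg := htb.isAlgebraic_field
    have hsub : ∀ w : K,
        w ∈ IntermediateField.adjoin k (Set.range (Sum.elim xv fun j => (yO j : K))) →
        w ∈ IntermediateField.adjoin (algebraMap k K).fieldRange
          (Set.range xv ∪ Set.range fun j => (yO j : K)) := by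
      intro w hw
      rw [← IntermediateField.mem_toSubfield, IntermediateField.adjoin_toSubfield] at hw ⊢
      refine Subfield.closure_mono ?_ hw
      rw [Set.Sum.elim_range, range_algebraMap_subfield, RingHom.coe_fieldRange]
    let incl : IntermediateField.adjoin k (Set.range (Sum.elim xv fun j => (yO j : K))) →+*
        IntermediateField.adjoin (algebraMap k K).fieldRange
          (Set.range xv ∪ Set.range fun j => (yO j : K)) :=
      { toFun := fun w => ⟨w, hsub w w.2⟩
        map_one' := rfl
        map_mul' := fun _ _ => rfl
        map_zero' := rfl
        map_add' := fun _ _ => rfl }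
    intro z _
    exact isAlgebraic_of_ringHom_comp_eq incl (RingHom.ext fun _ => rfl) (halg.isAlgebraic z)

end Abhyankar

/-! ## The registered stub -/

/-- **STUB (T3, ring form) of line `birth` of crux `SepExcModels`, PROVED: the composite of two
discrete valuations is a residually rational Abhyankar place.** Let `R` be a local domain with
fraction field `K` over a field `k`, `P` a prime of `R` such that `R_P` (`= W`) is a DVR and
`R ⧸ P` is a DVR, `y₁, …, y_τ ∈ R` with residues algebraically independent over `k`, and
`tr.deg_k K ≤ τ + 2`. Then there is a valuation ring `O` of `K` containing `R`, dominating it,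
Abhyankar over (the image of) `k`, and residually rational over `R`: the composite valuation
ring `O = {x ∈ W | x̄ ∈ R ⧸ P}` (`exists_composite_valuationSubring`, after realising the
abstract localisation `W` inside `K = Frac R = Frac W`), which is Abhyankar by
`isAbhyankarPlace_of_valuation_zpow` applied to `π ∈ P ∖ 0` and a lift `t ∈ R ∖ P` of a
uniformizing non-unit of `R ⧸ P`.
[cite: KnafKuhlmann2005, Thm. 2.1; folklore (Zariski–Samuel II, VI §10, composite valuations)] -/
theorem stub_ratAbhyankarPlace_of_dvrPair {k K R W : Type} [Field k] [Field K] [Algebra k K]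
    [CommRing R] [IsDomain R] [IsLocalRing R] [Algebra R K] [IsFractionRing R K]
    [Algebra k R] [IsScalarTower k R K]
    (P : Ideal R) [P.IsPrime]
    [CommRing W] [IsDomain W] [IsDiscreteValuationRing W] [Algebra R W] [IsLocalization.AtPrime W P]
    (hD : IsDiscreteValuationRing (R ⧸ P))
    {τ : ℕ} (y : Fin τ → R)
    (hy : AlgebraicIndependent k fun j => IsLocalRing.residue R (y j))
    (htr : Algebra.trdeg k K ≤ (τ + 2 : ℕ)) :
    ∃ O : ValuationSubring K, (∀ r : R, algebraMap R K r ∈ O) ∧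
      (∀ r ∈ IsLocalRing.maximalIdeal R, O.valuation (algebraMap R K r) < 1) ∧
      IsAbhyankarPlace O (algebraMap k K).fieldRange ⊤ ∧
      ∀ x ∈ O, ∃ r : R, O.valuation (algebraMap R K r - x) < 1 := by
  haveI := hD
  have hunit : ∀ s : P.primeCompl, IsUnit (algebraMap R K s) := fun s =>
    IsLocalization.map_units K ⟨(s : R), P.primeCompl_le_nonZeroDivisors s.2⟩
  letI : Algebra W K := (IsLocalization.lift (M := P.primeCompl) (S := W) hunit).toAlgebra
  haveI : IsScalarTower R W K :=
    IsScalarTower.of_algebraMap_eq fun r => (IsLocalization.lift_eq hunit r).symm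
  haveI : IsFractionRing W K :=
    IsFractionRing.isFractionRing_of_isDomain_of_isLocalization P.primeCompl W K
  obtain ⟨O, hRO, hdom, hrat, π, t, hπ, ht, hind⟩ := exists_composite_valuationSubring K P W
  exact ⟨O, hRO, hdom, isAbhyankarPlace_of_valuation_zpow O hRO hdom hπ ht hind y hy htr, hrat⟩

end Summit.ResolutionOfSingularities.ResolutionOfSingularities.Theorems.SepExcModels.DvrPairValuation

end
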